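import Summits.CriticalPhenomena.PercolationContinuityZ3.Theorems.PercNearOneGluingNoHeavyLowerTailSunflowerMultiPetalKempeMarkedOnePoint
import HarnessLib
import HarnessLib.Audit

/-!
# `NoHeavyLowerTail` (crux stmt-CriticalPhenomena-4575), marked-multigraph layer: the ONE-POINT EXPANSION of `TfunM` and
# MONOTONE DELETION OF A MARKED VERTEX (case (a) of the induction of FINDING-g47 §4, kernel-checked)

Support file (seat `prim-l12-p2` gen 47; `--supports stmt-CriticalPhenomena-4575`; continuation of `…KempeMarked` (p594349) and `…KempeMarkedOnePoint`
(p594654: `linkM`, `cntM_eq_isolate_add`)).  No `sorry`; nothing is asserted about the crux.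
Memo: run/shared/lean/prim/prim-l12/prim-l12-p2/FINDING-g47-NEIGHBOURHOOD-CONTRACTION-STEP.md §4(a), §6.

* `profM` — the capped colour profile of `N(y)` (multiplicity-weighted, the marks of `y` added to every coordinate);
* `ctypeM_eq_ctAdd_isolate` — TYPE DECOMPOSITION AT `y` on the same vertex type: `type_K σ = type_{K.isolate y} σ ⊕ xPart (σ y) (profM σ)`;
* `TfunM_eq_sum_extCol` — `TfunM` as a double sum over the colourings of `V ∖ {y}` and the colour of `y`;
* `three_mul_TfunM_sub_TfunM_isolate` — **`3·T(K) − T(K.isolate y) = 3·Σ_τ kerTAbs (type_{K−y} τ) (profM τ)`** (the marked-multigraph version of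
  p421779's `Tfun_sub_Tfun_induce_eq_sum_kerTAbs`; the factor `3` because `K.isolate y` keeps `y` as an isolated unmarked vertex);
* `TfunM_isolate_le_of_mark` — **if `mark y ≠ 0` then `T(K.isolate y) ≤ 3·T(K)`** (i.e. `T(K−y) ≤ T(K)`): every kernel value is `≥ 0` because no
  profile coordinate vanishes (`kerTAbs_nonneg_of_ne_zero`).  This is case (a) of the Lemma-B induction of the memo.
-/

namespace Summit.CriticalPhenomena.PercolationContinuityZ3.Theorems.SunflowerPartition.Kempe

open Finset

namespace MGraph

variable {V : Type*} [Fintype V] [LinearOrder V] (K : MGraph V)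

section OnePointExpansion

variable (y : V)

/-- The capped colour profile of `N(y)` (multiplicity-weighted, marks of `y` added to every colour). [this work] -/
def profM (σ : V → Fin 3) : CType :=
  (cap3 (K.linkM y σ 0 + K.mark y), cap3 (K.linkM y σ 1 + K.mark y), cap3 (K.linkM y σ 2 + K.mark y))

/-- `capAdd a 0 = a`. [this work] -/
theorem capAdd_zero_right : ∀ a : Fin 3, capAdd a 0 = a := by decide

/-- **Type decomposition at `y`** (same vertex type): the type of `σ` in `K` is the capped sum of its type in `K.isolate y` and the part carried by
`y` (the `σ y`-coordinate of the profile). [this work] -/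
theorem ctypeM_eq_ctAdd_isolate (σ : V → Fin 3) :
    K.ctypeM σ = ctAdd ((K.isolate y).ctypeM σ) (xPart (σ y) (K.profM y σ)) := by
  unfold ctypeM profM
  rw [K.cntM_eq_isolate_add y σ 0, K.cntM_eq_isolate_add y σ 1, K.cntM_eq_isolate_add y σ 2]
  unfold ctAdd xPart
  ext
  · by_cases h : σ y = 0
    · simp only [h, if_true, cap3_add]
    · simp only [if_neg h, add_zero, capAdd_zero_right]
  · by_cases h : σ y = 1
    · simp only [h, if_true, cap3_add]
    · simp only [if_neg h, add_zero, capAdd_zero_right]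
  · by_cases h : σ y = 2
    · simp only [h, if_true, cap3_add]
    · simp only [if_neg h, add_zero, capAdd_zero_right]


omit [Fintype V] [LinearOrder V] in
/-- `extCol` colourings that differ only at `y` agree off `y`. [this work] -/
theorem extCol_eq_of_ne (τ : (({y}ᶜ : Set V)) → Fin 3) (c c' : Fin 3) {w : V} (hw : w ≠ y) :
    extCol y τ c w = extCol y τ c' w := by
  rw [extCol_of_ne y τ c hw, extCol_of_ne y τ c' hw]

/-- In `K.isolate y` the member count does not depend on the colour of `y`. [this work] -/
theorem cntM_isolate_extCol (τ : (({y}ᶜ : Set V)) → Fin 3) (c c' d : Fin 3) :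
    (K.isolate y).cntM (extCol y τ c) d = (K.isolate y).cntM (extCol y τ c') d := by
  unfold cntM isolate
  simp only
  congr 1
  · refine sum_congr rfl fun x _ => sum_congr rfl fun z _ => ?_
    by_cases hxy : x = y ∨ z = y
    · simp [hxy]
    · push Not at hxy
      rw [extCol_eq_of_ne y τ c c' hxy.1, extCol_eq_of_ne y τ c c' hxy.2]
  · refine sum_congr rfl fun x _ => ?_
    by_cases hx : x = y
    · simp [hx]
    · rw [extCol_eq_of_ne y τ c c' hx]

/-- In `K.isolate y` the type does not depend on the colour of `y`. [this work] -/
theorem ctypeM_isolate_extCol (τ : (({y}ᶜ : Set V)) → Fin 3) (c c' : Fin 3) :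
    (K.isolate y).ctypeM (extCol y τ c) = (K.isolate y).ctypeM (extCol y τ c') := by
  unfold ctypeM
  rw [K.cntM_isolate_extCol y τ c c' 0, K.cntM_isolate_extCol y τ c c' 1, K.cntM_isolate_extCol y τ c c' 2]

/-- The profile of `N(y)` does not depend on the colour of `y`. [this work] -/
theorem profM_extCol (τ : (({y}ᶜ : Set V)) → Fin 3) (c c' : Fin 3) :
    K.profM y (extCol y τ c) = K.profM y (extCol y τ c') := by
  have hl : ∀ d : Fin 3, K.linkM y (extCol y τ c) d = K.linkM y (extCol y τ c') d := by
    intro d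
    unfold linkM
    refine sum_congr rfl fun w _ => ?_
    by_cases hw : w = y
    · simp [hw, K.loopless]
    · rw [extCol_eq_of_ne y τ c c' hw]
  unfold profM
  rw [hl 0, hl 1, hl 2]

/-- `TfunM` as a double sum over the colourings of `V ∖ {y}` and the colour of `y` (terminals `u, v ≠ y`). [this work] -/
theorem TfunM_eq_sum_extCol (u v : ({y}ᶜ : Set V)) :
    K.TfunM u.1 v.1 = ∑ τ ∈ univ.filter (fun τ : (({y}ᶜ : Set V)) → Fin 3 => τ u = 0 ∧ τ v = 1),
      ∑ c : Fin 3, fC (K.ctypeM (extCol y τ c)) := by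
  unfold TfunM
  rw [sum_filter, sum_filter]
  have hR : ∀ τ : (({y}ᶜ : Set V)) → Fin 3,
      (if τ u = 0 ∧ τ v = 1 then ∑ c : Fin 3, fC (K.ctypeM (extCol y τ c)) else 0)
        = ∑ c : Fin 3, (if τ u = 0 ∧ τ v = 1 then fC (K.ctypeM (extCol y τ c)) else 0) := by
    intro τ
    by_cases h : τ u = 0 ∧ τ v = 1
    · simp only [if_pos h]
    · simp only [if_neg h, sum_const_zero]
  rw [sum_congr rfl (fun τ _ => hR τ), ← Fintype.sum_prod_type']
  refine sum_nbij' (fun σ => (σ ∘ Subtype.val, σ y)) (fun p => extCol y p.1 p.2) (by simp) (by simp)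
    (fun σ _ => extCol_restrict y σ) (fun p _ => Prod.ext (extCol_comp_val y p.1 p.2) (extCol_self y p.1 p.2))
    (fun σ _ => ?_)
  dsimp only
  exact if_congr Iff.rfl (by rw [extCol_restrict]) rfl

/-- **THE ONE-POINT EXPANSION in the marked-multigraph layer**: `3·T(K) − T(K.isolate y) = 3·Σ_τ kerTAbs (type_{K−y} τ) (profile τ)` over the colourings
`τ` of `V ∖ {y}` with the terminal colours (the factor `3` on the right because `K.isolate y` keeps `y` as an isolated unmarked vertex). [this work] -/
theorem three_mul_TfunM_sub_TfunM_isolate (u v : ({y}ᶜ : Set V)) :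
    3 * K.TfunM u.1 v.1 - (K.isolate y).TfunM u.1 v.1
      = 3 * ∑ τ ∈ univ.filter (fun τ : (({y}ᶜ : Set V)) → Fin 3 => τ u = 0 ∧ τ v = 1),
          kerTAbs ((K.isolate y).ctypeM (extCol y τ 0)) (K.profM y (extCol y τ 0)) := by
  rw [K.TfunM_eq_sum_extCol y u v, (K.isolate y).TfunM_eq_sum_extCol y u v, mul_sum, mul_sum, ← sum_sub_distrib]
  refine sum_congr rfl fun τ _ => ?_
  unfold kerTAbs
  rw [Fin.sum_univ_three, Fin.sum_univ_three,
    K.ctypeM_eq_ctAdd_isolate y (extCol y τ 0), K.ctypeM_eq_ctAdd_isolate y (extCol y τ 1), K.ctypeM_eq_ctAdd_isolate y (extCol y τ 2),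
    extCol_self, extCol_self, extCol_self,
    K.ctypeM_isolate_extCol y τ 1 0, K.ctypeM_isolate_extCol y τ 2 0, K.profM_extCol y τ 1 0, K.profM_extCol y τ 2 0]
  unfold xPart
  simp only [if_true, Fin.isValue]
  ring_nf

/-- `cap3 n ≠ 0` for `n ≠ 0`. [this work] -/
theorem cap3_ne_zero {n : ℕ} (h : n ≠ 0) : cap3 n ≠ 0 := by
  unfold cap3
  intro hc
  have := congrArg Fin.val hc
  simp at this
  omega

/-- **A MARKED vertex is deleted monotonically** (memo §4(a), kernel-checked in the marked-multigraph layer): if `mark y ≠ 0` then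
`T(K.isolate y) ≤ 3·T(K)`, i.e. `T(K − y) ≤ T(K)`, because every one-point kernel value is nonnegative when no profile coordinate vanishes
(`kerTAbs_nonneg_of_ne_zero`, p421779). [this work] -/
theorem TfunM_isolate_le_of_mark (u v : ({y}ᶜ : Set V)) (hmark : K.mark y ≠ 0) :
    (K.isolate y).TfunM u.1 v.1 ≤ 3 * K.TfunM u.1 v.1 := by
  have h := K.three_mul_TfunM_sub_TfunM_isolate y u v
  have hnn : 0 ≤ ∑ τ ∈ univ.filter (fun τ : (({y}ᶜ : Set V)) → Fin 3 => τ u = 0 ∧ τ v = 1),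
      kerTAbs ((K.isolate y).ctypeM (extCol y τ 0)) (K.profM y (extCol y τ 0)) := by
    refine sum_nonneg fun τ _ => kerTAbs_nonneg_of_ne_zero _ _ ?_ ?_ ?_
    · exact cap3_ne_zero (by omega)
    · exact cap3_ne_zero (by omega)
    · exact cap3_ne_zero (by omega)
  linarith

end OnePointExpansion

end MGraph

end Summit.CriticalPhenomena.PercolationContinuityZ3.Theorems.SunflowerPartition.Kempe
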